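import Summits.CriticalPhenomena.PercolationContinuityZ3.Theorems.PercNearOneGluingNoHeavyQuantFarTwoAnchorReach
import HarnessLib

/-!
# QUANT lane R8, front "FAR beyond trees", layer one — TWO-HUB BLOCKS I: a two-anchor core whose anchors carry ARBITRARY pendant structures
# (reachability and the count decomposition)

builds on p205010 (kernel theorem, internal audit signed; external expert review pending)

Support file (`--supports stmt-CriticalPhenomena-4575`), seat `prim-quant-p1` (gen 19); memo
`run/shared/lean/prim/quant/prim-quant-p1-g19/FOR-LEAD-CACTI.md` §5 (cactus assembly without flattening).  Pure combinatorics; standard axioms; no sorries.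

`…QuantFarTwoAnchorReach` hung single leaves at the anchors.  Here the anchors `v₁, v₂` of the block `Z` (pendant at `c`) carry arbitrary vertex
sets `S₁, S₂ ⊆ Z` ("hubs": `Sᵢ` is joined only to `Sᵢ ∪ {vᵢ}`) — e.g. whole sub-cacti.  With `core Z (S₁ ∪ S₂) ω` the open pairs of the block
avoiding the hubs and `Block.inS S v ω` the open pairs inside `S ∪ {v}` meeting `S`:
* `Block.IsTwoHub`; `Block.on_reach_hub_iff`: for `a ∈ Sᵢ`, `c ↔ a on Z` iff `c ↔ vᵢ` through the core and `vᵢ ↔ a` inside `Sᵢ ∪ {vᵢ}`;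
* **`Block.card_on_eq_twoHub`** — if the block relays lie in `S₁ ∪ S₂ ∪ {v₁, v₂}`:
  `#{a ∈ A ∩ Z : c ↔ a on Z} = 𝟙[E₁]·(Y₁ + 𝟙[v₁ ∈ A]) + 𝟙[E₂]·(Y₂ + 𝟙[v₂ ∈ A])`, `Yᵢ = #{a ∈ A ∩ Sᵢ : vᵢ ↔ a inside Sᵢ ∪ {vᵢ}}`.
So the two-anchor algebra applies with the law of `Yᵢ + bᵢ` in place of a hair bundle: a block may be decoupled WITHOUT flattening what hangs below it.
[cite: Grimmett1999, §1.3 p. 10]; bookkeeping [this work].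
-/

namespace Summit.CriticalPhenomena.PercolationContinuityZ3.Theorems

namespace Quant

namespace Block

open Finset
open Literature.Probability.Percolation
open Bundle (offZ offZ_subset)
open scoped Classical

variable {n : ℕ}

/-- The open pairs inside `S ∪ {v}` that meet `S` (the inner pairs of a hub `S` hanging at `v`). [this work] -/
def inS (S : Finset (Fin n)) (v : Fin n) (ω : BondConfig (Fin n)) : BondConfig (Fin n) :=
  {e | e ∈ ω ∧ (∃ z ∈ S, z ∈ e) ∧ ∀ z, z ∈ e → z ∈ S ∨ z = v}

/-- On a configuration good for the hub (`Block.Good v S ω`: open pairs from `S` stay in `S ∪ {v}`), the open pairs meeting `S` are the inner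
pairs. [this work] -/
theorem onZ_eq_inS {S : Finset (Fin n)} {v : Fin n} {ω : BondConfig (Fin n)} (hω : Good v S ω) : onZ S ω = inS S v ω := by
  ext e
  constructor
  · rintro ⟨he, z, hz, hze⟩
    refine ⟨he, ⟨z, hz, hze⟩, fun y hy => ?_⟩
    by_cases hyS : y ∈ S
    · exact Or.inl hyS
    · right
      induction e using Sym2.ind with
      | h a b =>
        rcases Sym2.mem_iff.1 hze with rfl | rfl <;> rcases Sym2.mem_iff.1 hy with rfl | rfl
        · exact absurd hz hyS
        · exact hω z y (fun h => hyS (h ▸ hz)) he hz hyS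
        · exact hω z y (fun h => hyS (h ▸ hz)) (by rw [Sym2.eq_swap]; exact he) hz hyS
        · exact absurd hz hyS
  · rintro ⟨he, hz, -⟩; exact ⟨he, hz⟩

/-- The data of a two-hub block: `c ∉ Z`, disjoint hubs `S₁, S₂ ⊆ Z`, anchors `v₁ ≠ v₂` in `Z` outside the hubs. [this work] -/
structure IsTwoHub (c v₁ v₂ : Fin n) (Z S₁ S₂ : Finset (Fin n)) : Prop where
  cZ : c ∉ Z
  S₁Z : S₁ ⊆ Z
  S₂Z : S₂ ⊆ Z
  v₁Z : v₁ ∈ Z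
  v₂Z : v₂ ∈ Z
  v₁S₁ : v₁ ∉ S₁
  v₁S₂ : v₁ ∉ S₂
  v₂S₁ : v₂ ∉ S₁
  v₂S₂ : v₂ ∉ S₂
  hne : v₁ ≠ v₂
  disj : Disjoint S₁ S₂

section TwoHub

variable {c v₁ v₂ : Fin n} {Z S₁ S₂ : Finset (Fin n)} (H : IsTwoHub c v₁ v₂ Z S₁ S₂)
include H

omit H in
/-- Goodness is inherited by sub-configurations. [this work] -/
theorem good_mono {v : Fin n} {S : Finset (Fin n)} {ω ω' : BondConfig (Fin n)} (h : ω' ⊆ ω) (hω : Good v S ω) : Good v S ω' :=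
  fun x y hxy he hx hy => hω x y hxy (h he) hx hy

omit H in
/-- `onZ S (onZ Z ω) = onZ S ω` for `S ⊆ Z`. [this work] -/
theorem onZ_onZ {S : Finset (Fin n)} (hSZ : S ⊆ Z) (ω : BondConfig (Fin n)) : onZ S (onZ Z ω) = onZ S ω := by
  ext e
  constructor
  · rintro ⟨⟨he, -⟩, hz⟩; exact ⟨he, hz⟩
  · rintro ⟨he, z, hz, hze⟩; exact ⟨⟨he, z, hSZ hz, hze⟩, z, hz, hze⟩

omit H in
/-- `offZ S₂ (offZ S₁ (onZ Z ω)) = core Z (S₁ ∪ S₂) ω`. [this work] -/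
theorem offZ_offZ_onZ (ω : BondConfig (Fin n)) : offZ S₂ (offZ S₁ (onZ Z ω)) = core Z (S₁ ∪ S₂) ω := by
  ext e
  simp only [offZ, onZ, core, Set.mem_setOf_eq, Finset.mem_union]
  constructor
  · rintro ⟨⟨⟨he, hz⟩, h1⟩, h2⟩
    exact ⟨he, hz, fun ℓ hℓ => hℓ.elim (h1 ℓ) (h2 ℓ)⟩
  · rintro ⟨he, hz, h⟩
    exact ⟨⟨⟨he, hz⟩, fun z hz1 => h z (Or.inl hz1)⟩, fun z hz2 => h z (Or.inr hz2)⟩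

omit H in
/-- Symmetric form: `offZ S₁ (offZ S₂ (onZ Z ω)) = core Z (S₁ ∪ S₂) ω`. [this work] -/
theorem offZ_offZ_onZ' (ω : BondConfig (Fin n)) : offZ S₁ (offZ S₂ (onZ Z ω)) = core Z (S₁ ∪ S₂) ω := by
  ext e
  simp only [offZ, onZ, core, Set.mem_setOf_eq, Finset.mem_union]
  constructor
  · rintro ⟨⟨⟨he, hz⟩, h2⟩, h1⟩
    exact ⟨he, hz, fun ℓ hℓ => hℓ.elim (h1 ℓ) (h2 ℓ)⟩
  · rintro ⟨he, hz, h⟩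
    exact ⟨⟨⟨he, hz⟩, fun z hz2 => h z (Or.inr hz2)⟩, fun z hz1 => h z (Or.inl hz1)⟩

/-- **Hub vertices are reached through their anchor (hub 1).**  For `a ∈ S₁` and a configuration good for both hubs:
`c ↔ a on Z` iff `c ↔ v₁` through the core and `v₁ ↔ a` by the inner pairs of `S₁`. [this work] -/
theorem on_reach_hub_iff₁ {ω : BondConfig (Fin n)} (h₁ : Good v₁ S₁ ω) (h₂ : Good v₂ S₂ ω) {a : Fin n} (ha : a ∈ S₁) :
    (openGraph (onZ Z ω)).Reachable c a ↔
      (openGraph (core Z (S₁ ∪ S₂) ω)).Reachable c v₁ ∧ (openGraph (inS S₁ v₁ ω)).Reachable v₁ a := by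
  have hcS₁ : c ∉ S₁ := fun h => H.cZ (H.S₁Z h)
  have hcS₂ : c ∉ S₂ := fun h => H.cZ (H.S₂Z h)
  -- block `S₁` at `v₁` inside the configuration `onZ Z ω`, observer `c`
  have g₁ : Good v₁ S₁ (onZ Z ω) := good_mono (onZ_subset Z ω) h₁
  have step1 := reach_in_iff g₁ hcS₁ H.v₁S₁ ha
  rw [onZ_onZ H.S₁Z, onZ_eq_inS h₁] at step1
  -- then block `S₂` at `v₂` inside `offZ S₁ (onZ Z ω)`, target `v₁ ∉ S₂`
  have g₂ : Good v₂ S₂ (offZ S₁ (onZ Z ω)) := good_mono (fun e he => (offZ_subset _ _ he).1) h₂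
  have step2 := reach_off_iff g₂ hcS₂ H.v₁S₂
  rw [offZ_offZ_onZ] at step2
  rw [step1, step2]

/-- The mirror image of the hub data. [this work] -/
theorem _root_.Summit.CriticalPhenomena.PercolationContinuityZ3.Theorems.Quant.Block.IsTwoHub.symm : IsTwoHub c v₂ v₁ Z S₂ S₁ :=
  ⟨H.cZ, H.S₂Z, H.S₁Z, H.v₂Z, H.v₁Z, H.v₂S₂, H.v₂S₁, H.v₁S₂, H.v₁S₁, H.hne.symm, H.disj.symm⟩

/-- **Hub vertices are reached through their anchor (hub 2).** [this work] -/
theorem on_reach_hub_iff₂ {ω : BondConfig (Fin n)} (h₁ : Good v₁ S₁ ω) (h₂ : Good v₂ S₂ ω) {a : Fin n} (ha : a ∈ S₂) :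
    (openGraph (onZ Z ω)).Reachable c a ↔
      (openGraph (core Z (S₁ ∪ S₂) ω)).Reachable c v₂ ∧ (openGraph (inS S₂ v₂ ω)).Reachable v₂ a := by
  have := on_reach_hub_iff₁ H.symm h₂ h₁ ha
  rw [Finset.union_comm] at this
  exact this

/-- A non-hub vertex of the block is reached on `Z` iff it is reached through the core. [this work] -/
theorem on_reach_iff_hubCore {ω : BondConfig (Fin n)} (h₁ : Good v₁ S₁ ω) (h₂ : Good v₂ S₂ ω) {y : Fin n} (hy₁ : y ∉ S₁) (hy₂ : y ∉ S₂) :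
    (openGraph (onZ Z ω)).Reachable c y ↔ (openGraph (core Z (S₁ ∪ S₂) ω)).Reachable c y := by
  have hcS₁ : c ∉ S₁ := fun h => H.cZ (H.S₁Z h)
  have hcS₂ : c ∉ S₂ := fun h => H.cZ (H.S₂Z h)
  have g₁ : Good v₁ S₁ (onZ Z ω) := good_mono (onZ_subset Z ω) h₁
  have step1 := reach_off_iff g₁ hcS₁ hy₁
  have g₂ : Good v₂ S₂ (offZ S₁ (onZ Z ω)) := good_mono (fun e he => (offZ_subset _ _ he).1) h₂
  have step2 := reach_off_iff g₂ hcS₂ hy₂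
  rw [offZ_offZ_onZ] at step2
  rw [step1, step2]

/-- **The block count of a two-hub block.**  If `A ∩ Z ⊆ S₁ ∪ S₂ ∪ {v₁, v₂}`, then on a configuration good for both hubs
`#{a ∈ A ∩ Z : c ↔ a on Z} = 𝟙[c ↔ v₁ in core]·(Y₁ + 𝟙[v₁ ∈ A]) + 𝟙[c ↔ v₂ in core]·(Y₂ + 𝟙[v₂ ∈ A])` with
`Yᵢ = #{a ∈ A ∩ Sᵢ : vᵢ ↔ a by the inner pairs of Sᵢ}`. [this work] -/
theorem card_on_eq_twoHub {ω : BondConfig (Fin n)} (h₁ : Good v₁ S₁ ω) (h₂ : Good v₂ S₂ ω) {A : Finset (Fin n)}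
    (hA : A ∩ Z ⊆ S₁ ∪ S₂ ∪ {v₁, v₂}) :
    ((A ∩ Z).filter fun a => onZ Z ω ∈ openConn c a).card =
      (if core Z (S₁ ∪ S₂) ω ∈ openConn c v₁ then
        ((A ∩ S₁).filter fun a => inS S₁ v₁ ω ∈ openConn v₁ a).card + (if v₁ ∈ A then 1 else 0) else 0) +
      (if core Z (S₁ ∪ S₂) ω ∈ openConn c v₂ then
        ((A ∩ S₂).filter fun a => inS S₂ v₂ ω ∈ openConn v₂ a).card + (if v₂ ∈ A then 1 else 0) else 0) := by
  -- split `A ∩ Z` into the two hubs and the anchors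
  set R : Fin n → Prop := fun a => onZ Z ω ∈ openConn c a with hR
  have hpart : (A ∩ Z).filter R = ((A ∩ S₁).filter R ∪ (A ∩ S₂).filter R) ∪ (({v₁, v₂} : Finset (Fin n)).filter fun a => a ∈ A ∧ R a) := by
    ext a
    rw [Finset.mem_union, Finset.mem_union, Finset.mem_filter, Finset.mem_filter, Finset.mem_filter, Finset.mem_filter,
      Finset.mem_inter, Finset.mem_inter, Finset.mem_inter, Finset.mem_insert, Finset.mem_singleton]
    constructor
    · rintro ⟨⟨haA, haZ⟩, hr⟩
      have h := hA (Finset.mem_inter.2 ⟨haA, haZ⟩)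
      rw [Finset.mem_union, Finset.mem_union, Finset.mem_insert, Finset.mem_singleton] at h
      rcases h with (h | h) | h
      · exact Or.inl (Or.inl ⟨⟨haA, h⟩, hr⟩)
      · exact Or.inl (Or.inr ⟨⟨haA, h⟩, hr⟩)
      · exact Or.inr ⟨h, haA, hr⟩
    · rintro ((⟨⟨haA, h⟩, hr⟩ | ⟨⟨haA, h⟩, hr⟩) | ⟨h, haA, hr⟩)
      · exact ⟨⟨haA, H.S₁Z h⟩, hr⟩
      · exact ⟨⟨haA, H.S₂Z h⟩, hr⟩
      · rcases h with rfl | rfl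
        · exact ⟨⟨haA, H.v₁Z⟩, hr⟩
        · exact ⟨⟨haA, H.v₂Z⟩, hr⟩
  have hd12 : Disjoint ((A ∩ S₁).filter R) ((A ∩ S₂).filter R) := by
    rw [Finset.disjoint_left]
    intro a ha1 ha2
    exact Finset.disjoint_left.1 H.disj (Finset.mem_inter.1 (Finset.mem_filter.1 ha1).1).2
      (Finset.mem_inter.1 (Finset.mem_filter.1 ha2).1).2
  have hd3 : Disjoint ((A ∩ S₁).filter R ∪ (A ∩ S₂).filter R) (({v₁, v₂} : Finset (Fin n)).filter fun a => a ∈ A ∧ R a) := by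
    rw [Finset.disjoint_left]
    intro a ha hb
    have hb' := (Finset.mem_filter.1 hb).1
    rw [Finset.mem_insert, Finset.mem_singleton] at hb'
    rcases Finset.mem_union.1 ha with ha | ha
    · have haS := (Finset.mem_inter.1 (Finset.mem_filter.1 ha).1).2
      rcases hb' with rfl | rfl
      · exact H.v₁S₁ haS
      · exact H.v₂S₁ haS
    · have haS := (Finset.mem_inter.1 (Finset.mem_filter.1 ha).1).2
      rcases hb' with rfl | rfl
      · exact H.v₁S₂ haS
      · exact H.v₂S₂ haS
  have hanch : (({v₁, v₂} : Finset (Fin n)).filter fun a => a ∈ A ∧ R a).card = (if v₁ ∈ A ∧ R v₁ then 1 else 0) + (if v₂ ∈ A ∧ R v₂ then 1 else 0) := by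
    rw [Finset.card_filter, Finset.sum_pair H.hne]
  rw [hpart, Finset.card_union_of_disjoint hd3, Finset.card_union_of_disjoint hd12, hanch]
  -- hub classes
  have key₁ : ((A ∩ S₁).filter R).card =
      (if core Z (S₁ ∪ S₂) ω ∈ openConn c v₁ then ((A ∩ S₁).filter fun a => inS S₁ v₁ ω ∈ openConn v₁ a).card else 0) := by
    by_cases hE : core Z (S₁ ∪ S₂) ω ∈ openConn c v₁
    · rw [if_pos hE]
      refine congrArg _ (Finset.filter_congr fun a ha => ?_)
      change (openGraph (onZ Z ω)).Reachable c a ↔ _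
      rw [on_reach_hub_iff₁ H h₁ h₂ (Finset.mem_inter.1 ha).2]
      exact ⟨fun h => h.2, fun h => ⟨hE, h⟩⟩
    · rw [if_neg hE, Finset.card_eq_zero, Finset.filter_eq_empty_iff]
      intro a ha h
      exact hE ((on_reach_hub_iff₁ H h₁ h₂ (Finset.mem_inter.1 ha).2).1 h).1
  have key₂ : ((A ∩ S₂).filter R).card =
      (if core Z (S₁ ∪ S₂) ω ∈ openConn c v₂ then ((A ∩ S₂).filter fun a => inS S₂ v₂ ω ∈ openConn v₂ a).card else 0) := by
    by_cases hE : core Z (S₁ ∪ S₂) ω ∈ openConn c v₂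
    · rw [if_pos hE]
      refine congrArg _ (Finset.filter_congr fun a ha => ?_)
      change (openGraph (onZ Z ω)).Reachable c a ↔ _
      rw [on_reach_hub_iff₂ H h₁ h₂ (Finset.mem_inter.1 ha).2]
      exact ⟨fun h => h.2, fun h => ⟨hE, h⟩⟩
    · rw [if_neg hE, Finset.card_eq_zero, Finset.filter_eq_empty_iff]
      intro a ha h
      exact hE ((on_reach_hub_iff₂ H h₁ h₂ (Finset.mem_inter.1 ha).2).1 h).1
  rw [key₁, key₂]
  have r1 : R v₁ ↔ (core Z (S₁ ∪ S₂) ω ∈ openConn c v₁) := on_reach_iff_hubCore H h₁ h₂ H.v₁S₁ H.v₁S₂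
  have r2 : R v₂ ↔ (core Z (S₁ ∪ S₂) ω ∈ openConn c v₂) := on_reach_iff_hubCore H h₁ h₂ H.v₂S₁ H.v₂S₂
  rw [r1, r2]
  by_cases e1 : core Z (S₁ ∪ S₂) ω ∈ openConn c v₁ <;> by_cases e2 : core Z (S₁ ∪ S₂) ω ∈ openConn c v₂ <;>
    by_cases a1 : v₁ ∈ A <;> by_cases a2 : v₂ ∈ A <;>
    simp only [e1, e2, a1, a2, if_true, if_false, and_true, and_false] <;> omega

end TwoHub

end Block

end Quant

end Summit.CriticalPhenomena.PercolationContinuityZ3.Theorems
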